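/-
Origin: expansion seat `planner-pub-hodgecm-pohl-g15-0`, handover #14 2026-08-18T16:19:39Z (md5 dade968498b03b651f6c3d84eacfc375, 298 l.; RUN-32 CANDIDATE ROW, ON REQUEST ONLY — TREE-SHAPE SPLIT (≤400 l.) of the pohl lineage, source lines verbatim; NEW first part; lands AFTER RUN-30 GaloisSpanGeneric (c949714a) + GaloisSpanSubfield (16545630); no import rewrite) (`HOME/pub-hodgecm-pohl-g15/lean/Pohl15/GaloisSpanPairKernel.lean`, md5 dade9684, 298 lines);
landed by the packager successor (mc-unitary-1-g3, gen-8 kit) in gate run 32 as `HodgeCM/Proofs/Pohlmann/GaloisSpanPairKernel.lean` (verbatim).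
-/
/-
Copyright: pub-hodgecm formalisation cell (harness21, 2026). New file (not vendored).
Origin: HOME/pub-hodgecm-pohl-g15/lean/Pohl15/GaloisSpanPairKernel.lean — session planner-pub-hodgecm-pohl-g15-0 (unit pub-hodgecm-pohl-g15),
EXPANSION part (b) `PohlmannSpan`, generation 15: TREE-SHAPE STAGING under the 400-line rule of lean/CONVENTIONS.md §2 — part 1/2
of the split of `HodgeCM/Proofs/Pohlmann/GaloisSpanSexticClosure.lean` (pohl-g13 file 8, RUN 31 row d82eed87; 549 l., md5 d82eed87f499): source lines 53–323 VERBATIM; the module docstring below is new (it only describes the cut).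
Intended final place: `HodgeCM/Proofs/Pohlmann/GaloisSpanPairKernel.lean` (module `HodgeCM.Proofs.Pohlmann.GaloisSpanPairKernel`); imports final (certified package modules only).
-/
import Summits.HodgeConjecture.HodgeCM.Proofs.Pohlmann.GaloisSpanGeneric
import Summits.HodgeConjecture.HodgeCM.Proofs.Pohlmann.GaloisSpanSubfield

/-!
# The pair kernel of `Gal(F̃/ℚ)` on `Hom(F, ℂ)` and its flip sets

First half of pohl-g13's `GaloisSpanSexticClosure.lean` (RUN-31 row), split at its section boundary `end PairKernel` under the
tree's 400-line rule (lean/CONVENTIONS.md §2); every declaration below is the source's, verbatim.  `F` a CM field of degree `2g`,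
`F̃ = E^c` its Galois closure (`GaoUllmo.galoisClosure (Fin (0 + 1) → F)`), `G = Gal(F̃/ℚ)`.  Contents (`section PairKernel`): the
pair permutation `pairPermHom Θ : G →* Equiv.Perm ↥Θ.1` and its kernel `pairKer Θ` (the elements acting on `Hom(F, ℂ)` by flips
`s ↦ s̄` on a set of pairs), `card_pairKer_le_two_pow`, `exists_card_pairKer_eq_two_pow`, `|G| ∣ |pairKer|·g!`,
`galF_eq_swap_of_mem_pairKer`, and the flip sets of pair-kernel elements (`exists_galF_eq_swap_of_mem_pairKer_of_card_eq_three`).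
The orbit–stabiliser facts (`[F:ℚ] ∣ [F̃:ℚ]`, `F` Galois iff `[F̃:ℚ] = [F:ℚ]`) and the SEXTIC verdict (naive Pohlmann span iff
`[F̃:ℚ] ≠ 12`) are in `GaloisSpanSexticClosure.lean`, which imports this file and keeps the module name.  Nothing is cited.
-/

noncomputable section

open scoped TensorProduct NumberField BigOperators
open NumberField NumberField.ComplexEmbedding

attribute [local instance] Classical.propDecidable

namespace HodgeCM

open Literature.AlgebraicGeometry.Motives (CMType HodgeStructure)
open HodgeCM.Pohlmann HodgeCM.GaoUllmo HodgeCM.CMTypeOps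

namespace NonGalois

/-! ### The pair kernel -/

section PairKernel

variable {F : Type} [Field F] [NumberField F] [IsCMField F] (Θ : CMType F)

/-- (Ported verbatim from the HodgeCMPerL package; no docstring in the source.) -/
theorem pairRep_galF_pairRep (σ : galoisClosure (Fin (0 + 1) → F) ≃ₐ[ℚ] galoisClosure (Fin (0 + 1) → F)) (u : F →+* ℂ) :
    pairRep Θ (galF 0 σ (pairRep Θ u : F →+* ℂ)) = pairRep Θ (galF 0 σ u) := by
  rcases coe_pairRep_eq_or Θ u with h | h
  · rw [h]
  · rw [h, isBarCommuting_galF σ u, pairRep_conjugate]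

/-- (Ported verbatim from the HodgeCMPerL package; no docstring in the source.) -/
theorem pairPerm_mul (σ τ : galoisClosure (Fin (0 + 1) → F) ≃ₐ[ℚ] galoisClosure (Fin (0 + 1) → F)) :
    pairPerm Θ (σ * τ) = pairPerm Θ σ * pairPerm Θ τ := by
  refine Equiv.ext fun t => ?_
  rw [Equiv.Perm.mul_apply, pairPerm_apply, pairPerm_apply, pairPerm_apply, galF_mul, pairRep_galF_pairRep]

/-- (Ported verbatim from the HodgeCMPerL package; no docstring in the source.) -/
theorem pairPerm_one : pairPerm Θ 1 = 1 := by
  refine Equiv.ext fun t => ?_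
  rw [pairPerm_apply, Equiv.Perm.one_apply, galF_one, pairRep_coe]

/-- `σ ↦` the induced permutation of the conjugate pairs (`≃ Θ`), as a group homomorphism `Gal(F̃/ℚ) →* Perm(Θ)`. -/
def pairPermHom : (galoisClosure (Fin (0 + 1) → F) ≃ₐ[ℚ] galoisClosure (Fin (0 + 1) → F)) →* Equiv.Perm ↥Θ.1 where
  toFun := pairPerm Θ
  map_one' := pairPerm_one Θ
  map_mul' := pairPerm_mul Θ

/-- (Ported verbatim from the HodgeCMPerL package; no docstring in the source.) -/
theorem pairPermHom_apply (σ : galoisClosure (Fin (0 + 1) → F) ≃ₐ[ℚ] galoisClosure (Fin (0 + 1) → F)) :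
    pairPermHom Θ σ = pairPerm Θ σ := rfl

/-- The PAIR KERNEL `K ≤ Gal(F̃/ℚ)`: the elements mapping every conjugate pair `{t, t̄}` to itself. -/
def pairKer : Subgroup (galoisClosure (Fin (0 + 1) → F) ≃ₐ[ℚ] galoisClosure (Fin (0 + 1) → F)) :=
  (pairPermHom Θ).ker

/-- (Ported verbatim from the HodgeCMPerL package; no docstring in the source.) -/
theorem mem_pairKer_iff (σ : galoisClosure (Fin (0 + 1) → F) ≃ₐ[ℚ] galoisClosure (Fin (0 + 1) → F)) :
    σ ∈ pairKer Θ ↔ pairPerm Θ σ = 1 :=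
  (pairPermHom Θ).mem_ker

/-- Elements of the pair kernel map each `u ∈ Hom(F, ℂ)` to `u` or to `ū`. -/
theorem galF_eq_self_or_conjugate_of_mem_pairKer {σ : galoisClosure (Fin (0 + 1) → F) ≃ₐ[ℚ] galoisClosure (Fin (0 + 1) → F)}
    (hσ : σ ∈ pairKer Θ) (u : F →+* ℂ) : galF 0 σ u = u ∨ galF 0 σ u = conjugate u := by
  have hp : pairPerm Θ σ = 1 := (mem_pairKer_iff Θ σ).mp hσ
  have hΘ : ∀ (v : F →+* ℂ) (hv : v ∈ Θ.1), galF 0 σ v = v ∨ galF 0 σ v = conjugate v := fun v hv => by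
    rw [galF_eq_of_galCode Θ σ hv, hp, Equiv.Perm.one_apply]
    by_cases hs : galStays Θ σ ⟨v, hv⟩ = true
    · rw [if_pos hs]
      exact Or.inl rfl
    · rw [if_neg hs]
      exact Or.inr rfl
  by_cases hu : u ∈ Θ.1
  · exact hΘ u hu
  · have h1 := hΘ (conjugate u) ((conjugate_mem_iff_notMem Θ u).mpr hu)
    rw [isBarCommuting_galF σ u] at h1
    rcases h1 with h1 | h1
    · exact Or.inl ((involutive_conjugate F).injective h1)
    · exact Or.inr ((involutive_conjugate F).injective h1)

/-- Complex conjugation `c` lies in the pair kernel. -/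
theorem barAut_mem_pairKer : barAut F 0 ∈ pairKer Θ := by
  rw [mem_pairKer_iff]
  refine Equiv.ext fun t => ?_
  rw [pairPerm_apply, galF_barAut, pairRep_conjugate, pairRep_coe, Equiv.Perm.one_apply]

/-- The pair kernel has exponent `2`. -/
theorem mul_self_eq_one_of_mem_pairKer {κ : galoisClosure (Fin (0 + 1) → F) ≃ₐ[ℚ] galoisClosure (Fin (0 + 1) → F)}
    (hκ : κ ∈ pairKer Θ) : κ * κ = 1 := by
  refine galF_eq_id_iff.mp (funext fun u => ?_)
  rw [galF_mul, id]
  rcases galF_eq_self_or_conjugate_of_mem_pairKer Θ hκ u with h | h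
  · rw [h, h]
  · rw [h, isBarCommuting_galF κ u, h, involutive_conjugate]

/-- On the pair kernel the flip data alone determines the element. -/
theorem galStays_injOn_pairKer : Set.InjOn (galStays Θ) (pairKer Θ) := by
  intro κ hκ κ' hκ' h
  refine galCode_injective Θ ?_
  show (pairPerm Θ κ, galStays Θ κ) = (pairPerm Θ κ', galStays Θ κ')
  rw [(mem_pairKer_iff Θ κ).mp hκ, (mem_pairKer_iff Θ κ').mp hκ', h]

/-- `|K| ≤ 2^g`. -/
theorem card_pairKer_le_two_pow : Nat.card (pairKer Θ) ≤ 2 ^ (Module.finrank ℚ F / 2) := by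
  rw [← card_coe_type Θ, ← Fintype.card_bool, ← Fintype.card_fun, ← Nat.card_eq_fintype_card]
  refine Nat.card_le_card_of_injective (fun κ : pairKer Θ => galStays Θ (κ : galoisClosure (Fin (0 + 1) → F) ≃ₐ[ℚ] galoisClosure (Fin (0 + 1) → F))) ?_
  intro κ κ' h
  exact Subtype.ext (galStays_injOn_pairKer Θ κ.2 κ'.2 h)

/-- `|K|` is a power of `2` (exponent `2`). -/
theorem exists_card_pairKer_eq_two_pow : ∃ a : ℕ, Nat.card (pairKer Θ) = 2 ^ a := by
  refine IsPGroup.iff_card.mp fun κ => ⟨1, Subtype.ext ?_⟩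
  show ((κ : galoisClosure (Fin (0 + 1) → F) ≃ₐ[ℚ] galoisClosure (Fin (0 + 1) → F)) ^ 2 ^ 1) = 1
  rw [pow_one, pow_two]
  exact mul_self_eq_one_of_mem_pairKer Θ κ.2

/-- **`|Gal(F̃/ℚ)|` divides `|K| · g!`** (`G/K ↪ Perm(Θ) ≅ S_g`). -/
theorem card_aut_dvd_card_pairKer_mul_factorial :
    Nat.card (galoisClosure (Fin (0 + 1) → F) ≃ₐ[ℚ] galoisClosure (Fin (0 + 1) → F)) ∣
      Nat.card (pairKer Θ) * (Module.finrank ℚ F / 2).factorial := by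
  have h1 : Nat.card (pairKer Θ) * (pairKer Θ).index =
      Nat.card (galoisClosure (Fin (0 + 1) → F) ≃ₐ[ℚ] galoisClosure (Fin (0 + 1) → F)) := Subgroup.card_mul_index _
  have h2 : (pairKer Θ).index = Nat.card (pairPermHom Θ).range := Subgroup.index_ker _
  have h3 : Nat.card (pairPermHom Θ).range ∣ Nat.card (Equiv.Perm ↥Θ.1) := Subgroup.card_subgroup_dvd_card _
  rw [Nat.card_eq_fintype_card (α := Equiv.Perm ↥Θ.1), Fintype.card_perm, card_coe_type] at h3
  rw [← h1, h2]
  exact mul_dvd_mul_left _ h3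

/-! ### Flip sets of pair-kernel elements -/

/-- (Ported verbatim from the HodgeCMPerL package; no docstring in the source.) -/
theorem galF_eq_conjugate_iff_of_mem_pairKer {κ : galoisClosure (Fin (0 + 1) → F) ≃ₐ[ℚ] galoisClosure (Fin (0 + 1) → F)}
    (hκ : κ ∈ pairKer Θ) {t : F →+* ℂ} (ht : t ∈ Θ.1) : galF 0 κ t = conjugate t ↔ galF 0 κ t ∉ Θ.1 := by
  constructor
  · intro h
    rw [h]
    exact (mem_iff_conjugate_notMem Θ t).mp ht
  · intro h
    rcases galF_eq_self_or_conjugate_of_mem_pairKer Θ hκ t with h1 | h1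
    · rw [h1] at h
      exact absurd ht h
    · exact h1

/-- (Ported verbatim from the HodgeCMPerL package; no docstring in the source.) -/
theorem galF_eq_self_iff_of_mem_pairKer {κ : galoisClosure (Fin (0 + 1) → F) ≃ₐ[ℚ] galoisClosure (Fin (0 + 1) → F)}
    (hκ : κ ∈ pairKer Θ) {t : F →+* ℂ} (ht : t ∈ Θ.1) : galF 0 κ t = t ↔ galF 0 κ t ∈ Θ.1 := by
  constructor
  · intro h
    rw [h]
    exact ht
  · intro h
    rcases galF_eq_self_or_conjugate_of_mem_pairKer Θ hκ t with h1 | h1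
    · exact h1
    · rw [h1] at h
      exact absurd h ((mem_iff_conjugate_notMem Θ t).mp ht)

/-- **An element of the pair kernel flipping exactly one pair `{t₀, t̄₀}` is the single sign change `t₀ ↔ t̄₀`.** -/
theorem galF_eq_swap_of_mem_pairKer {κ : galoisClosure (Fin (0 + 1) → F) ≃ₐ[ℚ] galoisClosure (Fin (0 + 1) → F)}
    (hκ : κ ∈ pairKer Θ) {t₀ : F →+* ℂ} (ht₀ : t₀ ∈ Θ.1)
    (hflip : ∀ t : F →+* ℂ, t ∈ Θ.1 → (galF 0 κ t ∉ Θ.1 ↔ t = t₀)) :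
    galF 0 κ = Equiv.swap t₀ (conjugate t₀) := by
  have ht₀' : conjugate t₀ ∉ Θ.1 := (mem_iff_conjugate_notMem Θ t₀).mp ht₀
  have hΘ : ∀ t : F →+* ℂ, t ∈ Θ.1 → galF 0 κ t = if t = t₀ then conjugate t else t := fun t ht => by
    by_cases h : t = t₀
    · rw [if_pos h]
      exact (galF_eq_conjugate_iff_of_mem_pairKer Θ hκ ht).mpr ((hflip t ht).mpr h)
    · rw [if_neg h]
      exact (galF_eq_self_iff_of_mem_pairKer Θ hκ ht).mpr (not_not.mp fun hn => h ((hflip t ht).mp hn))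
  funext u
  by_cases hu : u ∈ Θ.1
  · rw [hΘ u hu]
    by_cases hut : u = t₀
    · rw [if_pos hut, hut, Equiv.swap_apply_left]
    · have hne : u ≠ conjugate t₀ := fun h' => ht₀' (h' ▸ hu)
      rw [if_neg hut, Equiv.swap_apply_of_ne_of_ne hut hne]
  · have h1 := hΘ (conjugate u) ((conjugate_mem_iff_notMem Θ u).mpr hu)
    rw [isBarCommuting_galF κ u] at h1
    have hut : u ≠ t₀ := fun h' => hu (h' ▸ ht₀)
    by_cases huc : conjugate u = t₀
    · rw [if_pos huc] at h1
      have hu' : u = conjugate t₀ := by rw [← huc, involutive_conjugate]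
      rw [(involutive_conjugate F).injective h1, hu', Equiv.swap_apply_right]
      exact involutive_conjugate F t₀
    · rw [if_neg huc] at h1
      have hne : u ≠ conjugate t₀ := fun h' => huc (by rw [h', involutive_conjugate])
      rw [Equiv.swap_apply_of_ne_of_ne hut hne]
      exact (involutive_conjugate F).injective h1

/-- `cκ` flips exactly the pairs that `κ ∈ K` does not. -/
theorem galF_barAut_mul_not_mem_iff {κ : galoisClosure (Fin (0 + 1) → F) ≃ₐ[ℚ] galoisClosure (Fin (0 + 1) → F)}
    (hκ : κ ∈ pairKer Θ) {t : F →+* ℂ} (ht : t ∈ Θ.1) : galF 0 (barAut F 0 * κ) t ∉ Θ.1 ↔ galF 0 κ t ∈ Θ.1 := by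
  rw [galF_barAut_mul]
  rcases galF_eq_self_or_conjugate_of_mem_pairKer Θ hκ t with h1 | h1
  · rw [h1]
    exact ⟨fun _ => ht, fun _ => (mem_iff_conjugate_notMem Θ t).mp ht⟩
  · rw [h1, involutive_conjugate]
    exact ⟨fun h => (h ht).elim, fun h => ((mem_iff_conjugate_notMem Θ t).mp ht h).elim⟩

/-- A non-trivial element of `K` flips some pair. -/
theorem exists_not_mem_of_mem_pairKer {κ : galoisClosure (Fin (0 + 1) → F) ≃ₐ[ℚ] galoisClosure (Fin (0 + 1) → F)}
    (hκ : κ ∈ pairKer Θ) (h1 : κ ≠ 1) : ∃ t ∈ Θ.1, galF 0 κ t ∉ Θ.1 := by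
  by_contra h
  refine h1 (galF_eq_id_iff.mp (funext fun u => ?_))
  have hΘ : ∀ t ∈ Θ.1, galF 0 κ t = t := fun t ht =>
    (galF_eq_self_iff_of_mem_pairKer Θ hκ ht).mpr (not_not.mp fun hn => h ⟨t, ht, hn⟩)
  by_cases hu : u ∈ Θ.1
  · exact hΘ u hu
  · have h2 := hΘ (conjugate u) ((conjugate_mem_iff_notMem Θ u).mpr hu)
    rw [isBarCommuting_galF κ u] at h2
    exact (involutive_conjugate F).injective h2

/-- An element of `K` other than `c` fixes some pair pointwise. -/
theorem exists_mem_of_mem_pairKer {κ : galoisClosure (Fin (0 + 1) → F) ≃ₐ[ℚ] galoisClosure (Fin (0 + 1) → F)}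
    (hκ : κ ∈ pairKer Θ) (hc : κ ≠ barAut F 0) : ∃ t ∈ Θ.1, galF 0 κ t ∈ Θ.1 := by
  by_contra h
  refine hc (eq_of_galF_eq (funext fun u => ?_))
  rw [galF_barAut]
  have hΘ : ∀ t ∈ Θ.1, galF 0 κ t = conjugate t := fun t ht =>
    (galF_eq_conjugate_iff_of_mem_pairKer Θ hκ ht).mpr fun hn => h ⟨t, ht, hn⟩
  by_cases hu : u ∈ Θ.1
  · exact hΘ u hu
  · have h2 := hΘ (conjugate u) ((conjugate_mem_iff_notMem Θ u).mpr hu)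
    rw [isBarCommuting_galF κ u, involutive_conjugate] at h2
    rw [← (involutive_conjugate F) (galF 0 κ u), h2]

/-- **Three pairs.**  If `g = 3`, any `κ ∈ K ∖ {1, c}` flips one or two pairs, so `κ` or `cκ` is a single sign change. -/
theorem exists_galF_eq_swap_of_mem_pairKer_of_card_eq_three (h3 : Fintype.card ↥Θ.1 = 3)
    {κ : galoisClosure (Fin (0 + 1) → F) ≃ₐ[ℚ] galoisClosure (Fin (0 + 1) → F)}
    (hκ : κ ∈ pairKer Θ) (h1 : κ ≠ 1) (hc : κ ≠ barAut F 0) :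
    ∃ (σ : galoisClosure (Fin (0 + 1) → F) ≃ₐ[ℚ] galoisClosure (Fin (0 + 1) → F)) (t₀ : F →+* ℂ),
      galF 0 σ = Equiv.swap t₀ (conjugate t₀) := by
  obtain ⟨A, hA⟩ : ∃ A : Finset ↥Θ.1, A = Finset.univ.filter (fun t : ↥Θ.1 => ¬ (galF 0 κ (t : F →+* ℂ) ∈ Θ.1)) := ⟨_, rfl⟩
  obtain ⟨B, hB⟩ : ∃ B : Finset ↥Θ.1, B = Finset.univ.filter (fun t : ↥Θ.1 => galF 0 κ (t : F →+* ℂ) ∈ Θ.1) := ⟨_, rfl⟩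
  have hmemA : ∀ (t : F →+* ℂ) (ht : t ∈ Θ.1), (⟨t, ht⟩ : ↥Θ.1) ∈ A ↔ galF 0 κ t ∉ Θ.1 := fun t ht => by
    rw [hA, Finset.mem_filter]
    exact ⟨fun h => h.2, fun h => ⟨Finset.mem_univ _, h⟩⟩
  have hmemB : ∀ (t : F →+* ℂ) (ht : t ∈ Θ.1), (⟨t, ht⟩ : ↥Θ.1) ∈ B ↔ galF 0 κ t ∈ Θ.1 := fun t ht => by
    rw [hB, Finset.mem_filter]
    exact ⟨fun h => h.2, fun h => ⟨Finset.mem_univ _, h⟩⟩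
  have hAB : B.card + A.card = 3 := by
    rw [hB, hA, Finset.card_filter_add_card_filter_not, Finset.card_univ, h3]
  have hApos : 0 < A.card := by
    obtain ⟨t, ht, hn⟩ := exists_not_mem_of_mem_pairKer Θ hκ h1
    exact Finset.card_pos.mpr ⟨⟨t, ht⟩, (hmemA t ht).mpr hn⟩
  have hBpos : 0 < B.card := by
    obtain ⟨t, ht, hn⟩ := exists_mem_of_mem_pairKer Θ hκ hc
    exact Finset.card_pos.mpr ⟨⟨t, ht⟩, (hmemB t ht).mpr hn⟩
  by_cases hA1 : A.card = 1
  · obtain ⟨x, hx⟩ := Finset.card_eq_one.mp hA1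
    refine ⟨κ, x, galF_eq_swap_of_mem_pairKer Θ hκ x.2 fun t ht => ?_⟩
    rw [← hmemA t ht, hx, Finset.mem_singleton, Subtype.ext_iff]
  · have hB1 : B.card = 1 := by omega
    obtain ⟨x, hx⟩ := Finset.card_eq_one.mp hB1
    refine ⟨barAut F 0 * κ, x,
      galF_eq_swap_of_mem_pairKer Θ ((pairKer Θ).mul_mem (barAut_mem_pairKer Θ) hκ) x.2 fun t ht => ?_⟩
    rw [galF_barAut_mul_not_mem_iff Θ hκ ht, ← hmemB t ht, hx, Finset.mem_singleton, Subtype.ext_iff]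

/-- If `|K| > 2` (`K ⊋ {1, c}`), some element of `K` is neither `1` nor `c`. -/
theorem exists_mem_pairKer_ne_of_two_lt_card (h : 2 < Nat.card (pairKer Θ)) :
    ∃ κ ∈ pairKer Θ, κ ≠ 1 ∧ κ ≠ barAut F 0 := by
  rw [Nat.card_eq_fintype_card] at h
  obtain ⟨a, b, c, hab, hac, hbc⟩ := Fintype.two_lt_card_iff.mp h
  by_cases ha : (a : galoisClosure (Fin (0 + 1) → F) ≃ₐ[ℚ] galoisClosure (Fin (0 + 1) → F)) ≠ 1 ∧
      (a : galoisClosure (Fin (0 + 1) → F) ≃ₐ[ℚ] galoisClosure (Fin (0 + 1) → F)) ≠ barAut F 0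
  · exact ⟨a, a.2, ha⟩
  by_cases hb : (b : galoisClosure (Fin (0 + 1) → F) ≃ₐ[ℚ] galoisClosure (Fin (0 + 1) → F)) ≠ 1 ∧
      (b : galoisClosure (Fin (0 + 1) → F) ≃ₐ[ℚ] galoisClosure (Fin (0 + 1) → F)) ≠ barAut F 0
  · exact ⟨b, b.2, hb⟩
  rw [not_and_or, not_not, not_not] at ha hb
  refine ⟨c, c.2, fun hc1 => ?_, fun hcc => ?_⟩
  · rcases ha with ha | ha
    · exact hac (Subtype.ext (ha.trans hc1.symm))
    · rcases hb with hb | hb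
      · exact hbc (Subtype.ext (hb.trans hc1.symm))
      · exact hab (Subtype.ext (ha.trans hb.symm))
  · rcases ha with ha | ha
    · rcases hb with hb | hb
      · exact hab (Subtype.ext (ha.trans hb.symm))
      · exact hbc (Subtype.ext (hb.trans hcc.symm))
    · exact hac (Subtype.ext (ha.trans hcc.symm))

end PairKernel

end NonGalois

end HodgeCM
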